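import Summits.BirchSwinnertonDyer.Rank1Residual.X11b.JetchevIndexRecordsKit
import HarnessLib

/-!
# BSD rank-≤1 residual cell, lane class X11b (`p ∥ N`: MULTIPLICATIVE at a prime `p ≥ 5`, `ρ̄_{E,p}` onto), rank ONE,
# Tamagawa-OBSTRUCTED with ONE Tamagawa prime: `BSD(E,p)` PER PAIR from Miller 2011 Thm. 5.4 (Cha case; FLAGGED) + GZK +
# a two-engine Jetchev HEEGNER-INDEX certificate in a DEEP field, the Tamagawa half and `E[p]` irreducible IN THE KERNEL — records 10

HONEST FRAMING (cell `b2b-bsdres-*`, verbatim): prove what is provable now; shrink each hard class to its core with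
data; no claim beyond stated classes; COMBINATION classes deleted from PUBLISHED theorems only, CONSTRUCTION-shaped
remainder typed; this is not "finishing BSD". X11b stays CONSTRUCTION-SHAPED; everything here is PER PAIR; no lane
verdict is changed; no named fact is introduced (debt 0: `hMJ`, `hGZK` are the tree's existing published named facts,
`hMJ` = Miller 2011 Thm. 5.4 in the Cha case carries the registry FLAGS `Miller11-Thm54-Cha-case` and `JET@p|N` —
these records are LITERAL currency, flag-free only the day director-bsd's ITEM (J∥) lands); nothing is booked by this
unit (census-lead, the Kurihara lane, the x11b lineage, bsd-jet and referee A decide what a record is worth); Cremona's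
numbers (`r_an = 1`, `#Ш_an`, models, generators, `∏ c_ℓ`, torsion, optimality / Manin codes, the galrep datum) and
the lane's per-prime `bad` tables are INPUTS.

Unit `b2b-bsdres-x11c`, GEN 33 (prover-b2b-bsdres-x11c-g33-0), move «JDEEP». POPULATION (`HOME/b2b-bsdres-x11c/gen33/jdeep/pop/`:
gen 32's class census `harvest_x11b_all.json` restricted to shape `tamobs` × this gen's zero-compute J-shape census of the
lane's own per-prime tables): of the 3 062 rank-ONE X11b cells at `p ≥ 5` that are OPEN on the Kurihara lane's residue of
record (bsdN sweep v4u/v5u) with `ρ̄_{E,p}` onto, `p ∤ #E(ℚ)_tors`, `p ∤ #Ш_an` but `p ∣ ∏ c_ℓ` (outside the Kolyvagin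
road of GEN 32's `KolyvaginIndexRecordsX11bRankOne01–95`), exactly **98 are «J1»: ONE prime `q ∣ N` with `p ∣ c_q`**
(always split multiplicative `Iₙ`, `w := ord_p c_q = ord_p n`; 82 @5, 15 @7, 1 @13; `q = p` itself for 27), 2 901 are J2
and 63 J3 (two / three such primes). For a J1 cell the Jetchev MAX-form bound `ord_p #Ш(E/ℚ) ≤ 2(ord_p [E(K):ℤy_K] −
max_q ord_p c_q)` reaches `0` in a Heegner field `K` with `ord_p [E(K):ℤy_K] = w` (Gross–Zagier + BSD over `K` predict
`ord_p [E(K):ℤy_K] = Σ_q ord_p c_q + ½ ord_p #Ш(E/K)`); the lane's fields of record (`|D| ≤ 1511`) read `w + 1` on every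
one of these 98 cells (the J1 cells with a `w`-field were booked T-JET literal and left the residue), so this gen ran the
cell's engine 1 DEEPER (VERBATIM, `NDISC 16` / `DBOUND 6000`) and found a `w`-field for the rows below; engine 2
(VERBATIM stdlib re-implementation) recomputes `m` EQUAL; the twist side (`E^D`: `#Ш_an`, `∏c`, torsion) is printed per
row (BSD-consistency: `ord_p #Ш_an(E^D) = 0`, `ord_p ∏c(E^D) = w`); the Tamagawa prime has THREE engines (A = Tate's
algorithm `tateY`, B = PARI `elllocalred`, C = the rank-2 observatory's certificate engine whose `TamLocal` certificate the
KERNEL re-checks). Kit jobs: engine 1 j268106 (14 c, 54 min), very deep j269293 (460020m1); engine 2 + twist values + Tamagawa engine B j269294 (8 c, 50 min); PARI third check j270395. Each record `bsdp_j<label>_<p>` is ONE application of the GEN 33 kit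
`X11b.bsdp_prime_of_jetchevIndex_of_tamLocal[_support]` (p496494; = the unit's gen-4 route
`bsdp_of_ainvs_of_jetchevChaCertificate` + kernel minimality + kernel irreducibility + n1011's kernel `c_q` transport) with
`decide` goals; binders displayed: `hMJ` (FLAGGED), `hGZK`, the Heegner datum (`K`, `p ∤ d_K`, `p² ∤ N`, `P = y_K` of
infinite order), `q ∣ N`, the index line `hv : ord_p [E(K):ℤP] ≤ w`, `r_an ≤ 1`, `#Ш_an` a `p`-adic unit. Currency:
LITERAL (the lane's T-JET row with flag `JET@p|N`; bucket-B-shaped for bsd-jet); every one of the 98 cells ALSO carries the unit's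
GEN 10 beyond-window DATA record (`X11b/BeyondWindowRecordsNN` ×95 / `BeyondWindowSurjRecordsNN` ×3, Skinner 2016 Thm. A /
Kato–Wuthrich road, binders as displayed there) — these records are a SECOND road for them. Table `HOME/b2b-bsdres-x11c/gen33/jdeep/JDEEP-TABLE.md`; population `jdeep/pop/JDEEP-POP.md`; J-shape census
`jdeep/pop/census_jpar.json`. Pairs in this file: `428400hx1`@7, `440895b1`@7, `463386x1`@7, `478800im1`@7, `240240ek1`@13, `307230ia1`@5, `220038bw1`@7.

References: R. L. Miller, LMS J. Comput. Math. 14 (2011) Thm. 5.4, Thm. 5.2, Thm. 4.1, Cor. 4.8, Def. 1.1 [Miller2011LMS];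
D. Jetchev, Compos. Math. 144 (2008) Thm. 1.1 [Jetchev2008]; B. H. Gross, D. Zagier, Invent. Math. 84 (1986) I (6.5)
[GrossZagier1986]; B. Mazur, Invent. Math. 44 (1978) Prop. 6.3 (1) [Mazur1978]; J. Tate, LNM 476 (1975) §7 [Tate1975];
J. H. Silverman, GTM 151 (1994) IV.9.4 [Silverman1994]; J. H. Silverman, *AEC* (2009) VII.1 Rem. 1.1, VII.6 Ex. 7.6
[SilvermanAEC2009]; A. Kraus, Acta Arith. 54 (1989) [Kraus1989]; J. E. Cremona, *Algorithms for Modular Elliptic Curves*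
(1997) §3.2, Table 1 [CremonaAlgorithms1997]; Cremona's tables [Cremona2006].
-/

set_option autoImplicit false

noncomputable section

open scoped Classical

open WeierstrassCurve Literature.NumberTheory.EllipticCurves
  Literature.NumberTheory.EllipticCurves.Rank1Residual
  Literature.NumberTheory.EllipticCurves.Rank1Residual.Typed
  Literature.NumberTheory.EllipticCurves.Miller2011
  Literature.NumberTheory.EllipticCurves.Rank1Residual.X11RankOneCertificates
  Summit.BirchSwinnertonDyer.BirchSwinnertonDyer.Rank1Residual.IntModel
  Summit.BirchSwinnertonDyer.BirchSwinnertonDyer.Rank1Residual.X11RankOne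
  Summit.BirchSwinnertonDyer.BirchSwinnertonDyer.Rank2Observatory.Tam
  Summit.BirchSwinnertonDyer.Rank1Residual.Additive

namespace Summit.BirchSwinnertonDyer.Rank1Residual.X11b

/-- **`BSD(E,7)` for `428400hx1`** (`N = 428400 = 2⁴·3²·5²·7·17`; SPLIT MULTIPLICATIVE at `7` (Kodaira `I7`, `c_7 = 7`); `#tors = 1`, `∏c = 42`,
`r_an = 1`, `#Ш_an = 1`, `ρ̄_{E,7}` onto (Cremona galrep: no code); lane residue cell `(7, X11b)` (bsdN v4u/v5u of record: `residue:X11b`);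
ALSO the unit's GEN 10 beyond-window DATA record in `X11b/BeyondWindowRecords57.lean` (binders as displayed there)). Tamagawa-OBSTRUCTED, shape J1: the ONLY prime `q ∣ N` with `7 ∣ c_q` is `q = p = 7` itself (Kodaira `I7` split, `c_7 = 7`, `w = ord_7 c_7 = 1`) — engines A (Tate `tateY`) = B (PARI
`elllocalred`, j269294) = C (observatory `TamLocal` ⟨7, 2, 1, 2, 0, 0, 0, 7, 0, 0, 7⟩, re-checked by the kernel below). Lane fields of record (`|D| ≤ 1511`): `-671`: `m = 588` (`ord = 2`).
DEEP FIELD `D = -1511` (prime): **`m = [E(K):ℤy_K] = 672`, `ord_7 m = 1 = w`** (`ρ = 112896`; `L'(E,1) = 5.859692072`, `L(E^D,1) = 2.381812977`, `ĥ(x) = 1.758943707`; `N_{E^D} = 978089036400`)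
— engine 1 (j268106) = engine 2 (j269294): `m = 672` EQUAL, dev. ≤ 6.8e-14, checks true; twist `E^D` (j269294): `N_F = 978089036400`, `#tors·∏c·#Ш_an = 1·168·16` — `ord_7 #Ш_an(E^D) = 0`, `ord_7 ∏c(E^D) = 1` — BSD-consistent. Jetchev MAX-form: `ord_7 #Ш(E/ℚ) ≤ 2(w − w) = 0 = ord_7 #Ш_an` ⇒ Miller's `BSD(E,7)` modulo the
displayed binders (`hMJ` FLAGGED `Miller11-Thm54-Cha-case`, `JET@p|N`; `hGZK`; Heegner datum; `hv`; `hr`; `hs`). Kernel: `Δ ≠ 0`,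
global minimality (bounded Kraus criterion), `7 ∣ Δ ∧ 7 ∤ c₄`, `E[7]` irreducible (`ℓ = 13`, `#Ẽ(𝔽_13) = 20`, `a_13 = -6`, `X² − a_ℓX + ℓ` root-free
mod `7`), `c_7(W/ℚ_7) = 7` (`TamLocal` ⟨7, 2, 1, 2, 0, 0, 0, 7, 0, 0, 7⟩). Per pair; LITERAL currency; nothing booked.
[cite: Miller2011LMS, Thm. 5.4 (arXiv:1010.2431 p. 11) and Def. 1.1] [cite: Jetchev2008, Thm. 1.1] [cite: Mazur1978, §6 Prop. 6.3 (1) (p. 153)]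
[cite: Silverman1994, IV.9.4] [cite: Cremona2006, Table 1 (label 428400hx1)] -/
theorem bsdp_j428400hx1_7 (hMJ : thm54_cha_padicValNat_shaOrder_add_tamagawa_le)
    (hGZK : rank_eq_analyticRank_of_analyticRank_le_one) (W : WeierstrassCurve ℚ)
    (hW : W = ⟨0, 0, 0, -369156000, 2728775590000⟩) {N : ℕ} [NeZero N] {K : Type} [Field K] [NumberField K]
    (hK : IsImaginaryQuadratic K) (hH : SatisfiesHeegnerHypothesis N K) {P : (W.baseChange K).toAffine.Point}
    (hP : IsHeegnerPoint N W K P) (hnt : ¬ IsOfFinAddOrder P) (hpD : ¬ (7 : ℤ) ∣ NumberField.discr K)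
    (hpN : ¬ 7 ^ 2 ∣ N) (hqN : 7 ∣ N) (hv : padicValNat 7 (AddSubgroup.zmultiples P).index ≤ 1)
    (hr : W.analyticRank ≤ 1) {s : ℚ} (hs : shaAn W = (s : ℂ)) (hvs : padicValRat 7 s = 0) : BSDp W 7 :=
  bsdp_prime_of_jetchevIndex_of_tamLocal 7 (by norm_num) (by norm_num) 0 0 0 (-369156000) 2728775590000 (by decide +kernel)
    (by decide +kernel) (by decide +kernel) (by decide +kernel) (by decide +kernel) 13 (by norm_num) (by norm_num) (by norm_num)
    (by decide +kernel) (n := 20) (by decide +kernel) (by decide +kernel) 7 (by norm_num) (T := ⟨7, 2, 1, 2, 0, 0, 0, 7, 0, 0, 7⟩) rfl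
    (by decide +kernel) (c := 7) (by decide +kernel) (w := 1) (by decide +kernel) hMJ hGZK W hW hK hH hP hnt (mod_cast hpD)
    hpN hqN hv hr hs hvs

/-- **`BSD(E,7)` for `440895b1`** (`N = 440895 = 3·5·7·13·17·19`; NON-SPLIT MULTIPLICATIVE at `7` (Kodaira `I22`, `c_7 = 2`); `#tors = 1`, `∏c = 28`,
`r_an = 1`, `#Ш_an = 1`, `ρ̄_{E,7}` onto (Cremona galrep: no code); lane residue cell `(7, X11b)` (bsdN v4u/v5u of record: `residue:X11b`);
ALSO the unit's GEN 10 beyond-window DATA record in `X11b/BeyondWindowRecords59.lean` (binders as displayed there)). Tamagawa-OBSTRUCTED, shape J1: the ONLY prime `q ∣ N` with `7 ∣ c_q` is `q = 13` (Kodaira `I7` split, `c_13 = 7`, `w = ord_7 c_13 = 1`) — engines A (Tate `tateY`) = B (PARI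
`elllocalred`, j269294) = C (observatory `TamLocal` ⟨13, 3, 1, 8, 0, 0, 0, 7, 0, 0, 7⟩, re-checked by the kernel below). Lane fields of record (`|D| ≤ 1511`): `-971`: `m = 784` (`ord = 2`).
DEEP FIELD `D = -1364` (2^2·11·31): **`m = [E(K):ℤy_K] = 672`, `ord_7 m = 1 = w`** (`ρ = 112896`; `L'(E,1) = 2.668990714`, `L(E^D,1) = 1.557400004`, `ĥ(x) = 18.07177436`; `N_{E^D} = 820283383920`)
— engine 1 (j268106) = engine 2 (j269294): `m = 672` EQUAL, dev. ≤ 4.6e-14, checks true; twist `E^D` (j269294): `N_F = 820283383920`, `#tors·∏c·#Ш_an = 1·56·144` — `ord_7 #Ш_an(E^D) = 0`, `ord_7 ∏c(E^D) = 1` — BSD-consistent. Jetchev MAX-form: `ord_7 #Ш(E/ℚ) ≤ 2(w − w) = 0 = ord_7 #Ш_an` ⇒ Miller's `BSD(E,7)` modulo the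
displayed binders (`hMJ` FLAGGED `Miller11-Thm54-Cha-case`, `JET@p|N`; `hGZK`; Heegner datum; `hv`; `hr`; `hs`). Kernel: `Δ ≠ 0`,
global minimality (support form, `bad = [(3, 1, 1), (5, 1, 3), (7, 1, 22), (13, 1, 7), (17, 1, 3), (19, 1, 2)]`), `7 ∣ Δ ∧ 7 ∤ c₄`, `E[7]` irreducible (`ℓ = 11`, `#Ẽ(𝔽_11) = 12`, `a_11 = 0`, `X² − a_ℓX + ℓ` root-free
mod `7`), `c_13(W/ℚ_13) = 7` (`TamLocal` ⟨13, 3, 1, 8, 0, 0, 0, 7, 0, 0, 7⟩). Per pair; LITERAL currency; nothing booked.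
[cite: Miller2011LMS, Thm. 5.4 (arXiv:1010.2431 p. 11) and Def. 1.1] [cite: Jetchev2008, Thm. 1.1] [cite: Mazur1978, §6 Prop. 6.3 (1) (p. 153)]
[cite: Silverman1994, IV.9.4] [cite: Cremona2006, Table 1 (label 440895b1)] -/
theorem bsdp_j440895b1_7 (hMJ : thm54_cha_padicValNat_shaOrder_add_tamagawa_le)
    (hGZK : rank_eq_analyticRank_of_analyticRank_le_one) (W : WeierstrassCurve ℚ)
    (hW : W = ⟨0, -1, 1, 84194831604, -17008628938650424⟩) {N : ℕ} [NeZero N] {K : Type} [Field K] [NumberField K]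
    (hK : IsImaginaryQuadratic K) (hH : SatisfiesHeegnerHypothesis N K) {P : (W.baseChange K).toAffine.Point}
    (hP : IsHeegnerPoint N W K P) (hnt : ¬ IsOfFinAddOrder P) (hpD : ¬ (7 : ℤ) ∣ NumberField.discr K)
    (hpN : ¬ 7 ^ 2 ∣ N) (hqN : 13 ∣ N) (hv : padicValNat 7 (AddSubgroup.zmultiples P).index ≤ 1)
    (hr : W.analyticRank ≤ 1) {s : ℚ} (hs : shaAn W = (s : ℂ)) (hvs : padicValRat 7 s = 0) : BSDp W 7 :=
  bsdp_prime_of_jetchevIndex_of_tamLocal_support 7 (by norm_num) (by norm_num) 0 (-1) 1 84194831604 (-17008628938650424) (by decide +kernel)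
    [(3, 1, 1), (5, 1, 3), (7, 1, 22), (13, 1, 7), (17, 1, 3), (19, 1, 2)] (by decide +kernel) (by decide +kernel) (by decide +kernel)
    (by decide +kernel) (by decide +kernel) 11 (by norm_num) (by norm_num) (by norm_num)
    (by decide +kernel) (n := 12) (by decide +kernel) (by decide +kernel) 13 (by norm_num) (T := ⟨13, 3, 1, 8, 0, 0, 0, 7, 0, 0, 7⟩) rfl
    (by decide +kernel) (c := 7) (by decide +kernel) (w := 1) (by decide +kernel) hMJ hGZK W hW hK hH hP hnt (mod_cast hpD)
    hpN hqN hv hr hs hvs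

/-- **`BSD(E,7)` for `463386x1`** (`N = 463386 = 2·3·7·11·17·59`; NON-SPLIT MULTIPLICATIVE at `7` (Kodaira `I7`, `c_7 = 1`); `#tors = 1`, `∏c = 7`,
`r_an = 1`, `#Ш_an = 1`, `ρ̄_{E,7}` onto (Cremona galrep: no code); lane residue cell `(7, X11b)` (bsdN v4u/v5u of record: `residue:X11b`);
ALSO the unit's GEN 10 beyond-window DATA record in `X11b/BeyondWindowRecords63.lean` (binders as displayed there)). Tamagawa-OBSTRUCTED, shape J1: the ONLY prime `q ∣ N` with `7 ∣ c_q` is `q = 2` (Kodaira `I7` split, `c_2 = 7`, `w = ord_7 c_2 = 1`) — engines A (Tate `tateY`) = B (PARI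
`elllocalred`, j269294) = C (observatory `TamLocal` ⟨2, 1, 1, 0, 0, 0, 0, 7, 0, 0, 7⟩, re-checked by the kernel below). Lane fields of record (`|D| ≤ 1511`): `-1055`: `m = 98` (`ord = 2`).
DEEP FIELD `D = -2855` (5·571): **`m = [E(K):ℤy_K] = 14`, `ord_7 m = 1 = w`** (`ρ = 49`; `L'(E,1) = 6.922205612`, `L(E^D,1) = 0.04128517325`, `ĥ(x) = 5.165795081`; `N_{E^D} = 3777070870650`)
— engine 1 (j268106) = engine 2 (j269294): `m = 14` EQUAL, dev. ≤ 1.6e-12, checks true; twist `E^D` (j269294): `N_F = 3777070870650`, `#tors·∏c·#Ш_an = 1·7·1` — `ord_7 #Ш_an(E^D) = 0`, `ord_7 ∏c(E^D) = 1` — BSD-consistent. Jetchev MAX-form: `ord_7 #Ш(E/ℚ) ≤ 2(w − w) = 0 = ord_7 #Ш_an` ⇒ Miller's `BSD(E,7)` modulo the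
displayed binders (`hMJ` FLAGGED `Miller11-Thm54-Cha-case`, `JET@p|N`; `hGZK`; Heegner datum; `hv`; `hr`; `hs`). Kernel: `Δ ≠ 0`,
global minimality (bounded Kraus criterion), `7 ∣ Δ ∧ 7 ∤ c₄`, `E[7]` irreducible (`ℓ = 5`, `#Ẽ(𝔽_5) = 9`, `a_5 = -3`, `X² − a_ℓX + ℓ` root-free
mod `7`), `c_2(W/ℚ_2) = 7` (`TamLocal` ⟨2, 1, 1, 0, 0, 0, 0, 7, 0, 0, 7⟩). Per pair; LITERAL currency; nothing booked.
[cite: Miller2011LMS, Thm. 5.4 (arXiv:1010.2431 p. 11) and Def. 1.1] [cite: Jetchev2008, Thm. 1.1] [cite: Mazur1978, §6 Prop. 6.3 (1) (p. 153)]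
[cite: Silverman1994, IV.9.4] [cite: Cremona2006, Table 1 (label 463386x1)] -/
theorem bsdp_j463386x1_7 (hMJ : thm54_cha_padicValNat_shaOrder_add_tamagawa_le)
    (hGZK : rank_eq_analyticRank_of_analyticRank_le_one) (W : WeierstrassCurve ℚ)
    (hW : W = ⟨1, 1, 1, -389857, -91274593⟩) {N : ℕ} [NeZero N] {K : Type} [Field K] [NumberField K]
    (hK : IsImaginaryQuadratic K) (hH : SatisfiesHeegnerHypothesis N K) {P : (W.baseChange K).toAffine.Point}
    (hP : IsHeegnerPoint N W K P) (hnt : ¬ IsOfFinAddOrder P) (hpD : ¬ (7 : ℤ) ∣ NumberField.discr K)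
    (hpN : ¬ 7 ^ 2 ∣ N) (hqN : 2 ∣ N) (hv : padicValNat 7 (AddSubgroup.zmultiples P).index ≤ 1)
    (hr : W.analyticRank ≤ 1) {s : ℚ} (hs : shaAn W = (s : ℂ)) (hvs : padicValRat 7 s = 0) : BSDp W 7 :=
  bsdp_prime_of_jetchevIndex_of_tamLocal 7 (by norm_num) (by norm_num) 1 1 1 (-389857) (-91274593) (by decide +kernel)
    (by decide +kernel) (by decide +kernel) (by decide +kernel) (by decide +kernel) 5 (by norm_num) (by norm_num) (by norm_num)
    (by decide +kernel) (n := 9) (by decide +kernel) (by decide +kernel) 2 (by norm_num) (T := ⟨2, 1, 1, 0, 0, 0, 0, 7, 0, 0, 7⟩) rfl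
    (by decide +kernel) (c := 7) (by decide +kernel) (w := 1) (by decide +kernel) hMJ hGZK W hW hK hH hP hnt (mod_cast hpD)
    hpN hqN hv hr hs hvs

/-- **`BSD(E,7)` for `478800im1`** (`N = 478800 = 2⁴·3²·5²·7·19`; SPLIT MULTIPLICATIVE at `7` (Kodaira `I7`, `c_7 = 7`); `#tors = 1`, `∏c = 56`,
`r_an = 1`, `#Ш_an = 1`, `ρ̄_{E,7}` onto (Cremona galrep: no code); lane residue cell `(7, X11b)` (bsdN v4u/v5u of record: `residue:X11b`);
ALSO the unit's GEN 10 beyond-window DATA record in `X11b/BeyondWindowRecords66.lean` (binders as displayed there)). Tamagawa-OBSTRUCTED, shape J1: the ONLY prime `q ∣ N` with `7 ∣ c_q` is `q = p = 7` itself (Kodaira `I7` split, `c_7 = 7`, `w = ord_7 c_7 = 1`) — engines A (Tate `tateY`) = B (PARI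
`elllocalred`, j269294) = C (observatory `TamLocal` ⟨7, 2, 1, 4, 0, 0, 0, 7, 0, 0, 7⟩, re-checked by the kernel below). Lane fields of record (`|D| ≤ 1511`): `-839`: `m = 784` (`ord = 2`).
DEEP FIELD `D = -1511` (prime): **`m = [E(K):ℤy_K] = 560`, `ord_7 m = 1 = w`** (`ρ = 78400`; `L'(E,1) = 8.483973778`, `L(E^D,1) = 1.344282333`, `ĥ(x) = 1.432076696`; `N_{E^D} = 1093158334800`)
— engine 1 (j268106) = engine 2 (j269294): `m = 560` EQUAL, dev. ≤ 2.0e-15, checks true; twist `E^D` (j269294): `N_F = 1093158334800`, `#tors·∏c·#Ш_an = 1·112·25` — `ord_7 #Ш_an(E^D) = 0`, `ord_7 ∏c(E^D) = 1` — BSD-consistent. Jetchev MAX-form: `ord_7 #Ш(E/ℚ) ≤ 2(w − w) = 0 = ord_7 #Ш_an` ⇒ Miller's `BSD(E,7)` modulo the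
displayed binders (`hMJ` FLAGGED `Miller11-Thm54-Cha-case`, `JET@p|N`; `hGZK`; Heegner datum; `hv`; `hr`; `hs`). Kernel: `Δ ≠ 0`,
global minimality (bounded Kraus criterion), `7 ∣ Δ ∧ 7 ∤ c₄`, `E[7]` irreducible (`ℓ = 13`, `#Ẽ(𝔽_13) = 11`, `a_13 = 3`, `X² − a_ℓX + ℓ` root-free
mod `7`), `c_7(W/ℚ_7) = 7` (`TamLocal` ⟨7, 2, 1, 4, 0, 0, 0, 7, 0, 0, 7⟩). Per pair; LITERAL currency; nothing booked.
[cite: Miller2011LMS, Thm. 5.4 (arXiv:1010.2431 p. 11) and Def. 1.1] [cite: Jetchev2008, Thm. 1.1] [cite: Mazur1978, §6 Prop. 6.3 (1) (p. 153)]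
[cite: Silverman1994, IV.9.4] [cite: Cremona2006, Table 1 (label 478800im1)] -/
theorem bsdp_j478800im1_7 (hMJ : thm54_cha_padicValNat_shaOrder_add_tamagawa_le)
    (hGZK : rank_eq_analyticRank_of_analyticRank_le_one) (W : WeierstrassCurve ℚ)
    (hW : W = ⟨0, 0, 0, -267681000, 1685704137500⟩) {N : ℕ} [NeZero N] {K : Type} [Field K] [NumberField K]
    (hK : IsImaginaryQuadratic K) (hH : SatisfiesHeegnerHypothesis N K) {P : (W.baseChange K).toAffine.Point}
    (hP : IsHeegnerPoint N W K P) (hnt : ¬ IsOfFinAddOrder P) (hpD : ¬ (7 : ℤ) ∣ NumberField.discr K)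
    (hpN : ¬ 7 ^ 2 ∣ N) (hqN : 7 ∣ N) (hv : padicValNat 7 (AddSubgroup.zmultiples P).index ≤ 1)
    (hr : W.analyticRank ≤ 1) {s : ℚ} (hs : shaAn W = (s : ℂ)) (hvs : padicValRat 7 s = 0) : BSDp W 7 :=
  bsdp_prime_of_jetchevIndex_of_tamLocal 7 (by norm_num) (by norm_num) 0 0 0 (-267681000) 1685704137500 (by decide +kernel)
    (by decide +kernel) (by decide +kernel) (by decide +kernel) (by decide +kernel) 13 (by norm_num) (by norm_num) (by norm_num)
    (by decide +kernel) (n := 11) (by decide +kernel) (by decide +kernel) 7 (by norm_num) (T := ⟨7, 2, 1, 4, 0, 0, 0, 7, 0, 0, 7⟩) rfl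
    (by decide +kernel) (c := 7) (by decide +kernel) (w := 1) (by decide +kernel) hMJ hGZK W hW hK hH hP hnt (mod_cast hpD)
    hpN hqN hv hr hs hvs

/-- **`BSD(E,13)` for `240240ek1`** (`N = 240240 = 2⁴·3·5·7·11·13`; SPLIT MULTIPLICATIVE at `13` (Kodaira `I1`, `c_13 = 1`); `#tors = 1`, `∏c = 13`,
`r_an = 1`, `#Ш_an = 1`, `ρ̄_{E,13}` onto (Cremona galrep: no code); lane residue cell `(13, X11b)` (bsdN v4u/v5u of record: `residue:X11b`);
ALSO the unit's GEN 10 beyond-window DATA record in `X11b/BeyondWindowRecords28.lean` (binders as displayed there)). Tamagawa-OBSTRUCTED, shape J1: the ONLY prime `q ∣ N` with `13 ∣ c_q` is `q = 3` (Kodaira `I13` split, `c_3 = 13`, `w = ord_13 c_3 = 1`) — engines A (Tate `tateY`) = B (PARI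
`elllocalred`, j269294) = C (observatory `TamLocal` ⟨3, 1, 1, 2, 0, 0, 0, 13, 0, 0, 13⟩, re-checked by the kernel below). Lane fields of record (`|D| ≤ 1511`): `-1559`: `m = 338` (`ord = 2`).
DEEP FIELD `D = -2999` (prime): **`m = [E(K):ℤy_K] = 26`, `ord_13 m = 1 = w`** (`ρ = 169`; `L'(E,1) = 7.995196984`, `L(E^D,1) = 0.02859184911`, `ĥ(x) = 5.172412868`; `N_{E^D} = 2160718800240`)
— engine 1 (j268106) = engine 2 (j269294): `m = 26` EQUAL, dev. ≤ 5.4e-14, checks true; twist `E^D` (j269294): `N_F = 2160718800240`, `#tors·∏c·#Ш_an = 1·26·1` — `ord_13 #Ш_an(E^D) = 0`, `ord_13 ∏c(E^D) = 1` — BSD-consistent. Jetchev MAX-form: `ord_13 #Ш(E/ℚ) ≤ 2(w − w) = 0 = ord_13 #Ш_an` ⇒ Miller's `BSD(E,13)` modulo the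
displayed binders (`hMJ` FLAGGED `Miller11-Thm54-Cha-case`, `JET@p|N`; `hGZK`; Heegner datum; `hv`; `hr`; `hs`). Kernel: `Δ ≠ 0`,
global minimality (bounded Kraus criterion), `13 ∣ Δ ∧ 13 ∤ c₄`, `E[13]` irreducible (`ℓ = 17`, `#Ẽ(𝔽_17) = 15`, `a_17 = 3`, `X² − a_ℓX + ℓ` root-free
mod `13`), `c_3(W/ℚ_3) = 13` (`TamLocal` ⟨3, 1, 1, 2, 0, 0, 0, 13, 0, 0, 13⟩). Per pair; LITERAL currency; nothing booked.
[cite: Miller2011LMS, Thm. 5.4 (arXiv:1010.2431 p. 11) and Def. 1.1] [cite: Jetchev2008, Thm. 1.1] [cite: Mazur1978, §6 Prop. 6.3 (1) (p. 153)]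
[cite: Silverman1994, IV.9.4] [cite: Cremona2006, Table 1 (label 240240ek1)] -/
theorem bsdp_j240240ek1_13 (hMJ : thm54_cha_padicValNat_shaOrder_add_tamagawa_le)
    (hGZK : rank_eq_analyticRank_of_analyticRank_le_one) (W : WeierstrassCurve ℚ)
    (hW : W = ⟨0, 1, 0, -1291256, 2914994319⟩) {N : ℕ} [NeZero N] {K : Type} [Field K] [NumberField K]
    (hK : IsImaginaryQuadratic K) (hH : SatisfiesHeegnerHypothesis N K) {P : (W.baseChange K).toAffine.Point}
    (hP : IsHeegnerPoint N W K P) (hnt : ¬ IsOfFinAddOrder P) (hpD : ¬ (13 : ℤ) ∣ NumberField.discr K)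
    (hpN : ¬ 13 ^ 2 ∣ N) (hqN : 3 ∣ N) (hv : padicValNat 13 (AddSubgroup.zmultiples P).index ≤ 1)
    (hr : W.analyticRank ≤ 1) {s : ℚ} (hs : shaAn W = (s : ℂ)) (hvs : padicValRat 13 s = 0) : BSDp W 13 :=
  bsdp_prime_of_jetchevIndex_of_tamLocal 13 (by norm_num) (by norm_num) 0 1 0 (-1291256) 2914994319 (by decide +kernel)
    (by decide +kernel) (by decide +kernel) (by decide +kernel) (by decide +kernel) 17 (by norm_num) (by norm_num) (by norm_num)
    (by decide +kernel) (n := 15) (by decide +kernel) (by decide +kernel) 3 (by norm_num) (T := ⟨3, 1, 1, 2, 0, 0, 0, 13, 0, 0, 13⟩) rfl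
    (by decide +kernel) (c := 13) (by decide +kernel) (w := 1) (by decide +kernel) hMJ hGZK W hW hK hH hP hnt (mod_cast hpD)
    hpN hqN hv hr hs hvs

/-- **`BSD(E,5)` for `307230ia1`** (`N = 307230 = 2·3·5·7²·11·19`; SPLIT MULTIPLICATIVE at `5` (Kodaira `I7`, `c_5 = 7`); `#tors = 1`, `∏c = 2520`,
`r_an = 1`, `#Ш_an = 1`, `ρ̄_{E,5}` onto (Cremona galrep: no code); lane residue cell `(5, X11b)` (bsdN v4u/v5u of record: `residue:X11b`);
ALSO the unit's GEN 10 beyond-window DATA record in `X11b/BeyondWindowRecords38.lean` (binders as displayed there)). Tamagawa-OBSTRUCTED, shape J1: the ONLY prime `q ∣ N` with `5 ∣ c_q` is `q = 3` (Kodaira `I15` split, `c_3 = 15`, `w = ord_5 c_3 = 1`) — engines A (Tate `tateY`) = B (PARI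
`elllocalred`, j269294) = C (observatory `TamLocal` ⟨3, 1, 1, 0, 0, 0, 0, 15, 0, 0, 15⟩, re-checked by the kernel below). Lane fields of record (`|D| ≤ 1511`): `-1319`: `m = 25200` (`ord = 2`).
DEEP FIELD `D = -2351` (prime): **`m = [E(K):ℤy_K] = 35280`, `ord_5 m = 1 = w`** (`ρ = 311169600`; `L'(E,1) = 19.28241685`, `L(E^D,1) = 25.99897884`, `ĥ(x) = 0.1551182046`; `N_{E^D} = 1698121963230`)
— engine 1 (j268106) = engine 2 (j269294): `m = 35280` EQUAL, dev. ≤ 5.8e-14, checks true but engine 2's internal `lattice_j_selfcheck` — RESOLVED by the PARI period third check j270395 (gen 28 recipe: ω₁, Im ω₂, covolume agree with engine 2 to ≤ 6.7e-17; j(ω₂/ω₁) = c₄³/Δ to ≤ 1.5e-76; the failed self-check is engine 2's 400-term q-series at the unreduced τ, not the lattice); twist `E^D` (j269294): `N_F = 1698121963230`, `#tors·∏c·#Ш_an = 1·5040·49` — `ord_5 #Ш_an(E^D) = 0`, `ord_5 ∏c(E^D) = 1` — BSD-consistent. Jetchev MAX-form: `ord_5 #Ш(E/ℚ) ≤ 2(w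 − w) = 0 = ord_5 #Ш_an` ⇒ Miller's `BSD(E,5)` modulo the
displayed binders (`hMJ` FLAGGED `Miller11-Thm54-Cha-case`, `JET@p|N`; `hGZK`; Heegner datum; `hv`; `hr`; `hs`). Kernel: `Δ ≠ 0`,
global minimality (bounded Kraus criterion), `5 ∣ Δ ∧ 5 ∤ c₄`, `E[5]` irreducible (`ℓ = 31`, `#Ẽ(𝔽_31) = 26`, `a_31 = 6`, `X² − a_ℓX + ℓ` root-free
mod `5`), `c_3(W/ℚ_3) = 15` (`TamLocal` ⟨3, 1, 1, 0, 0, 0, 0, 15, 0, 0, 15⟩). Per pair; LITERAL currency; nothing booked.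
[cite: Miller2011LMS, Thm. 5.4 (arXiv:1010.2431 p. 11) and Def. 1.1] [cite: Jetchev2008, Thm. 1.1] [cite: Mazur1978, §6 Prop. 6.3 (1) (p. 153)]
[cite: Silverman1994, IV.9.4] [cite: Cremona2006, Table 1 (label 307230ia1)] -/
theorem bsdp_j307230ia1_5 (hMJ : thm54_cha_padicValNat_shaOrder_add_tamagawa_le)
    (hGZK : rank_eq_analyticRank_of_analyticRank_le_one) (W : WeierstrassCurve ℚ)
    (hW : W = ⟨1, 0, 0, -47824923210, 4025585968955172⟩) {N : ℕ} [NeZero N] {K : Type} [Field K] [NumberField K]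
    (hK : IsImaginaryQuadratic K) (hH : SatisfiesHeegnerHypothesis N K) {P : (W.baseChange K).toAffine.Point}
    (hP : IsHeegnerPoint N W K P) (hnt : ¬ IsOfFinAddOrder P) (hpD : ¬ (5 : ℤ) ∣ NumberField.discr K)
    (hpN : ¬ 5 ^ 2 ∣ N) (hqN : 3 ∣ N) (hv : padicValNat 5 (AddSubgroup.zmultiples P).index ≤ 1)
    (hr : W.analyticRank ≤ 1) {s : ℚ} (hs : shaAn W = (s : ℂ)) (hvs : padicValRat 5 s = 0) : BSDp W 5 :=
  bsdp_prime_of_jetchevIndex_of_tamLocal 5 (by norm_num) (by norm_num) 1 0 0 (-47824923210) 4025585968955172 (by decide +kernel)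
    (by decide +kernel) (by decide +kernel) (by decide +kernel) (by decide +kernel) 31 (by norm_num) (by norm_num) (by norm_num)
    (by decide +kernel) (n := 26) (by decide +kernel) (by decide +kernel) 3 (by norm_num) (T := ⟨3, 1, 1, 0, 0, 0, 0, 15, 0, 0, 15⟩) rfl
    (by decide +kernel) (c := 15) (by decide +kernel) (w := 1) (by decide +kernel) hMJ hGZK W hW hK hH hP hnt (mod_cast hpD)
    hpN hqN hv hr hs hvs

/-- **`BSD(E,7)` for `220038bw1`** (`N = 220038 = 2·3·7·13²·31`; SPLIT MULTIPLICATIVE at `7` (Kodaira `I7`, `c_7 = 7`); `#tors = 1`, `∏c = 364`,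
`r_an = 1`, `#Ш_an = 1`, `ρ̄_{E,7}` onto (Cremona galrep: no code); lane residue cell `(7, X11b)` (bsdN v4u/v5u of record: `residue:X11b`);
ALSO the unit's GEN 10 beyond-window DATA record in `X11b/BeyondWindowRecords26.lean` (binders as displayed there)). Tamagawa-OBSTRUCTED, shape J1: the ONLY prime `q ∣ N` with `7 ∣ c_q` is `q = p = 7` itself (Kodaira `I7` split, `c_7 = 7`, `w = ord_7 c_7 = 1`) — engines A (Tate `tateY`) = B (PARI
`elllocalred`, j269294) = C (observatory `TamLocal` ⟨7, 2, 1, 4, 0, 0, 0, 7, 0, 0, 7⟩, re-checked by the kernel below). Lane fields of record (`|D| ≤ 1511`): `-647`: `m = 5096` (`ord = 2`).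
DEEP FIELD `D = -1511` (prime): **`m = [E(K):ℤy_K] = 2184`, `ord_7 m = 1 = w`** (`ρ = 1192464`; `L'(E,1) = 5.840839909`, `L(E^D,1) = 1.402735135`, `ĥ(x) = 0.1965676444`; `N_{E^D} = 502373378598`)
— engine 1 (j268106) = engine 2 (j269294): `m = 2184` EQUAL, dev. ≤ 9.3e-14, checks true but engine 2's internal `lattice_j_selfcheck` — RESOLVED by the PARI period third check j270395 (gen 28 recipe: ω₁, Im ω₂, covolume agree with engine 2 to ≤ 7.9e-17; j(ω₂/ω₁) = c₄³/Δ to ≤ 3.1e-76; the failed self-check is engine 2's 400-term q-series at the unreduced τ, not the lattice); twist `E^D` (j269294): `N_F = 502373378598`, `#tors·∏c·#Ш_an = 1·728·9` — `ord_7 #Ш_an(E^D) = 0`, `ord_7 ∏c(E^D) = 1` — BSD-consistent. Jetchev MAX-form: `ord_7 #Ш(E/ℚ) ≤ 2(w − w) = 0 = ord_7 #Ш_an` ⇒ Miller's `BSD(E,7)` modulo the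
displayed binders (`hMJ` FLAGGED `Miller11-Thm54-Cha-case`, `JET@p|N`; `hGZK`; Heegner datum; `hv`; `hr`; `hs`). Kernel: `Δ ≠ 0`,
global minimality (bounded Kraus criterion), `7 ∣ Δ ∧ 7 ∤ c₄`, `E[7]` irreducible (`ℓ = 5`, `#Ẽ(𝔽_5) = 9`, `a_5 = -3`, `X² − a_ℓX + ℓ` root-free
mod `7`), `c_7(W/ℚ_7) = 7` (`TamLocal` ⟨7, 2, 1, 4, 0, 0, 0, 7, 0, 0, 7⟩). Per pair; LITERAL currency; nothing booked.
[cite: Miller2011LMS, Thm. 5.4 (arXiv:1010.2431 p. 11) and Def. 1.1] [cite: Jetchev2008, Thm. 1.1] [cite: Mazur1978, §6 Prop. 6.3 (1) (p. 153)]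
[cite: Silverman1994, IV.9.4] [cite: Cremona2006, Table 1 (label 220038bw1)] -/
theorem bsdp_j220038bw1_7 (hMJ : thm54_cha_padicValNat_shaOrder_add_tamagawa_le)
    (hGZK : rank_eq_analyticRank_of_analyticRank_le_one) (W : WeierstrassCurve ℚ)
    (hW : W = ⟨1, 0, 1, -6769275075, 214368127424830⟩) {N : ℕ} [NeZero N] {K : Type} [Field K] [NumberField K]
    (hK : IsImaginaryQuadratic K) (hH : SatisfiesHeegnerHypothesis N K) {P : (W.baseChange K).toAffine.Point}
    (hP : IsHeegnerPoint N W K P) (hnt : ¬ IsOfFinAddOrder P) (hpD : ¬ (7 : ℤ) ∣ NumberField.discr K)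
    (hpN : ¬ 7 ^ 2 ∣ N) (hqN : 7 ∣ N) (hv : padicValNat 7 (AddSubgroup.zmultiples P).index ≤ 1)
    (hr : W.analyticRank ≤ 1) {s : ℚ} (hs : shaAn W = (s : ℂ)) (hvs : padicValRat 7 s = 0) : BSDp W 7 :=
  bsdp_prime_of_jetchevIndex_of_tamLocal 7 (by norm_num) (by norm_num) 1 0 1 (-6769275075) 214368127424830 (by decide +kernel)
    (by decide +kernel) (by decide +kernel) (by decide +kernel) (by decide +kernel) 5 (by norm_num) (by norm_num) (by norm_num)
    (by decide +kernel) (n := 9) (by decide +kernel) (by decide +kernel) 7 (by norm_num) (T := ⟨7, 2, 1, 4, 0, 0, 0, 7, 0, 0, 7⟩) rfl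
    (by decide +kernel) (c := 7) (by decide +kernel) (w := 1) (by decide +kernel) hMJ hGZK W hW hK hH hP hnt (mod_cast hpD)
    hpN hqN hv hr hs hvs

end Summit.BirchSwinnertonDyer.Rank1Residual.X11b

end
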